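import Literature.NumberTheory.ConnesMoscovici2022.UVProlateVonNeumann
import Literature.NumberTheory.ConnesMoscovici2022.UVProlateCutoffCommutation
import Literature.NumberTheory.ConnesMoscovici2022.UVProlateSymmetryAtInfinity
import HarnessLib

/-!
# Connes–Moscovici 2022, Theorem 1.6: the ASSEMBLY skeleton (what is in the tree, what remains)

LINE 1 — FRAMING. RH-FREE corpus literature (self-adjointness theory of the prolate wave operator
`W_λ = −∂ₓ(λ² − x²)∂ₓ + (2πλx)²` on `L²(ℝ)`; cell rh-crit C1, sequel row O2 `UVProlateSpectrum`, no
leaf / binder role).  bears_on: LADDER-RH W-C/W-P only.  WHAT THIS IS NOT: any claim about `ζ` or RH;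
nothing here bears on the truth of RH.  Theorems only (0 defs, 0 named facts); `CM22_thm_1_6` STAYS a
named fact — this file only reduces it to named, separately provable inputs.

Source: A. Connes, H. Moscovici, *The UV prolate spectrum matches the zeros of zeta*, PNAS 119 (2022)
[bib `ConnesMoscovici2022`] = arXiv:2112.05500, Thm 1.6 (= arXiv Thm 2.6, chunk p0006:L76–L79;
proof L81–L114): «(i) `W_sa` is selfadjoint and commutes with the Fourier transform. (ii) `W_sa`
commutes with the projections `P_λ` and `P̂_λ`. (iii) `W_sa` is the only selfadjoint extension of
`W_min` commuting with `P_λ` and `P̂_λ`. (iv) The spectrum of `W_sa` is discrete and unbounded on both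
sides.»  Proof of (iii) as printed: «The domain of a selfadjoint extension of `W_min` commuting with
`P_λ` and `P̂_λ` must be contained in `dom W_max` and also contain both `P_λ𝒮(ℝ)` and `P̂_λ𝒮(ℝ)`.
Thus it must contain `𝓛_β`, and cannot be larger due to self-adjointness.»

## What is proved

* **`isSelfAdjoint_prolateSA_of_minDomain_le_of_independent`** — clause (i), self-adjointness of
  `W_sa`, from TWO remaining inputs: `dom W_min ⊆ 𝓛_β` and four vectors of `𝓛_β` (the printed
  `β±, β̂±`) independent modulo `dom W_min`; the symmetry of `W_sa` is the tree's
  `prolateSA_isSymmetric` (`UVProlateSymmetryAtInfinity.lean`, seat cc-t6) and the dimension count is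
  `isSelfAdjoint_prolateSA_of_independent` (`UVProlateVonNeumann.lean`);
  `…_of_omegaMatrix` — the same with independence certified by a `4 × 4` corner `(Ω(vⱼ, uᵢ))` of the
  `Ω`-matrix of Lemma 1.5 (test vectors `vⱼ` = the `α`'s);
* **`CM22_thm_1_6_iii_of`** — clause (iii) from the self-adjointness of `W_sa` and the domain
  inclusion «a self-adjoint `W' ⊇ W_min` commuting with `P_λ, P̂_λ` has `𝓛_β ⊆ dom W'`» (maximality
  of self-adjoint operators, `IsProlateSA.eq_of_isSelfAdjoint_of_subset`);
* **`CM22_thm_1_6_of`** — the whole named fact from: (i) self-adjointness of `prolateSA λ`,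
  (i) `CommutesWith (prolateSA λ) fourierL2`, (ii) `CommutesWith (prolateSA λ) (cutoffProjHat λ)`
  (the `P_λ` half is the tree's `CM22_thm_1_6_ii_cutoffProj`, seat cc-t14), (iii) the domain inclusion
  above, (iv) `HasDiscreteSpectrumUnboundedBothSides (prolateSA λ)` — using `isProlateSA_iff`
  (`W = prolateSA λ`) and `exists_isProlateSA` for the opening clause;
* (second pass) the domain inclusion of (iii): `prolateSASet_subset_domain_of_commutesWith` — if
  `𝓛_β = dom W_min + span{u₁, …, u₄}` with each `uᵢ = P_λ f` or `P̂_λ f`, `f ∈ 𝒮(ℝ)`, then every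
  `W' ⊇ W_min` commuting with `P_λ, P̂_λ` has `𝓛_β ⊆ dom W'`; hence **`CM22_thm_1_6_iii_of_struct`**
  and the structural assembly **`CM22_thm_1_6_of_struct`** (inputs: (i)-SA, (i)-𝓕, (ii)-`P̂_λ`, the
  structure of `𝓛_β`, (iv)).

Nothing in this file bears on the truth of RH.
-/

noncomputable section

open Complex Set MeasureTheory Filter
open scoped InnerProductSpace
open _root_.LinearPMap Literature.Analysis.UnboundedOperators

namespace Literature.NumberTheory.ConnesMoscovici2022

open Literature.NumberTheory.ConnesConsani2021 Literature.NumberTheory.ConnesConsani2024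

variable {lam : ℝ}

/-- **Thm 1.6 (i), self-adjointness of `W_sa`, from the two remaining inputs**: `dom W_min ⊆ 𝓛_β` and
four vectors of `𝓛_β` linearly independent modulo `dom W_min` (the printed `β±, β̂±`); symmetry of
`W_sa` is the tree's `prolateSA_isSymmetric`, the count `4 = m₊ = m₋` is Lemma 1.1.
[cite: ConnesMoscovici2022, Thm 1.6 (i) with Lemma 1.1 / Lemma 1.5 and the `ℰ`-paragraph (= arXiv:2112.05500 Thm 2.6 (i), chunk p0006:L76–L81); EdmundsEvans2018, Ch. III §4 Thm 4.8 (4.11)] -/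
theorem isSelfAdjoint_prolateSA_of_minDomain_le_of_independent (hlam : 0 < lam)
    (hmin : (prolateMin lam).domain ≤ prolateSADomain lam hlam)
    (u : Fin 4 → L2R) (hu : ∀ i, u i ∈ prolateSASet lam)
    (hind : ∀ c : Fin 4 → ℂ, (∑ i, c i • u i) ∈ (prolateMin lam).domain → c = 0) :
    IsSelfAdjoint (prolateSA lam hlam) :=
  isSelfAdjoint_prolateSA_of_independent hlam hmin (prolateSA_isSymmetric hlam) u hu hind

/-- The same with the independence of `u₁, …, u₄` modulo `dom W_min` certified by test vectors
`v₁, …, v₄ ∈ dom W_max` (the printed `α±, α̂±`): the corner `(Ω(vⱼ, uᵢ))` of the `Ω`-matrix of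
Lemma 1.5 has trivial kernel. [cite: ConnesMoscovici2022, Thm 1.6 (i) with Lemma 1.5 and its proof (= arXiv:2112.05500 Thm 2.6 (i), Lemma 2.5, chunk p0005:L84–L104)] -/
theorem isSelfAdjoint_prolateSA_of_minDomain_le_of_omegaMatrix (hlam : 0 < lam)
    (hmin : (prolateMin lam).domain ≤ prolateSADomain lam hlam)
    (u : Fin 4 → L2R) (hu : ∀ i, u i ∈ prolateSASet lam)
    (v : Fin 4 → L2R) (hv : ∀ j, v j ∈ (prolateMax lam).domain)
    (hM : ∀ c : Fin 4 → ℂ,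
      (∀ j, ∑ i, omegaForm lam ⟨v j, hv j⟩ ⟨u i, (hu i).1⟩ * c i = 0) → c = 0) :
    IsSelfAdjoint (prolateSA lam hlam) :=
  isSelfAdjoint_prolateSA_of_minDomain_le_of_independent hlam hmin u hu
    (independent_mod_of_omegaMatrix₂ u (fun i => (hu i).1) v hv hM)

/-- **Thm 1.6 (iii) from (i) and the domain inclusion**: once `W_sa` is self-adjoint, every
self-adjoint extension `W'` of `W_min` commuting with `P_λ` and `P̂_λ` equals `W_sa` PROVIDED such a
`W'` has `𝓛_β ⊆ dom W'` («must contain both `P_λ𝒮(ℝ)` and `P̂_λ𝒮(ℝ)`, thus `𝓛_β`» — the remaining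
input; «cannot be larger due to self-adjointness» is the tree's maximality lemma).
[cite: ConnesMoscovici2022, Thm 1.6 (iii) and its proof (= arXiv:2112.05500 Thm 2.6 (iii), chunk p0006:L76–L79, L91–L93)] -/
theorem CM22_thm_1_6_iii_of (hlam : 0 < lam) (hSA : IsSelfAdjoint (prolateSA lam hlam))
    (hdom : ∀ W' : L2R →ₗ.[ℂ] L2R, IsSelfAdjoint W' → prolateMin lam ≤ W' →
      CommutesWith W' (cutoffProj lam) → CommutesWith W' (cutoffProjHat lam) →
      prolateSASet lam ⊆ (W'.domain : Set L2R))
    {W : L2R →ₗ.[ℂ] L2R} (hW : IsProlateSA lam W) :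
    ∀ W' : L2R →ₗ.[ℂ] L2R, IsSelfAdjoint W' → prolateMin lam ≤ W' →
      CommutesWith W' (cutoffProj lam) → CommutesWith W' (cutoffProjHat lam) → W' = W := by
  intro W' h1 h2 h3 h4
  have hWsa : IsSelfAdjoint W := by rw [hW.eq_prolateSA hlam]; exact hSA
  exact hW.eq_of_isSelfAdjoint_of_subset hWsa h1 h2 (hdom W' h1 h2 h3 h4)

/-- **Assembly of the named fact `CM22_thm_1_6` from named inputs** (all about THE operator
`prolateSA λ = W_sa`, by `isProlateSA_iff`): (i) self-adjointness, (i) commutation with `𝓕`,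
(ii) commutation with `P̂_λ` (the `P_λ` half is the tree's `CM22_thm_1_6_ii_cutoffProj`), (iii) the
domain inclusion for self-adjoint extensions commuting with `P_λ, P̂_λ`, (iv) discrete two-sided
unbounded spectrum.  `CM22_thm_1_6` itself stays a named fact until these land.
[cite: ConnesMoscovici2022, Thm 1.6 (i)–(iv) (= arXiv:2112.05500 Thm 2.6, chunk p0006:L76–L79; proof L81–L114)] -/
theorem CM22_thm_1_6_of
    (hSA : ∀ (lam : ℝ) (hlam : 0 < lam), IsSelfAdjoint (prolateSA lam hlam))
    (hF : ∀ (lam : ℝ) (hlam : 0 < lam), CommutesWith (prolateSA lam hlam) fourierL2)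
    (hPhat : ∀ (lam : ℝ) (hlam : 0 < lam), CommutesWith (prolateSA lam hlam) (cutoffProjHat lam))
    (hdom : ∀ (lam : ℝ) (_ : 0 < lam) (W' : L2R →ₗ.[ℂ] L2R), IsSelfAdjoint W' →
      prolateMin lam ≤ W' → CommutesWith W' (cutoffProj lam) → CommutesWith W' (cutoffProjHat lam) →
      prolateSASet lam ⊆ (W'.domain : Set L2R))
    (hspec : ∀ (lam : ℝ) (hlam : 0 < lam), HasDiscreteSpectrumUnboundedBothSides (prolateSA lam hlam)) :
    CM22_thm_1_6 := by
  intro lam hlam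
  refine ⟨exists_isProlateSA lam hlam, fun W hW => ?_⟩
  have hWeq : W = prolateSA lam hlam := hW.eq_prolateSA hlam
  refine ⟨hWeq ▸ hSA lam hlam, hWeq ▸ hF lam hlam, CM22_thm_1_6_ii_cutoffProj lam hlam W hW,
    hWeq ▸ hPhat lam hlam, CM22_thm_1_6_iii_of hlam (hSA lam hlam) (hdom lam hlam) hW,
    hWeq ▸ hspec lam hlam⟩

/-! ### The domain inclusion of Thm 1.6 (iii): «must contain `P_λ𝒮(ℝ)` and `P̂_λ𝒮(ℝ)`, thus `𝓛_β`» -/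

/-- plumbing: the core `𝒮(ℝ) = dom (W|_𝒮)` lies in the domain of every extension `W' ⊇ W_min`. [cite: ConnesMoscovici2022, Thm 1.6 (iii) and its proof: «must … contain both `P_λ𝒮(ℝ)` and `P̂_λ𝒮(ℝ)`. Thus it must contain `𝓛_β`» (= arXiv:2112.05500 Thm 2.6 (iii), chunk p0006:L76–L79, L91–L93)] -/
theorem prolateCore_domain_le_of_prolateMin_le {W' : L2R →ₗ.[ℂ] L2R} (hW' : prolateMin lam ≤ W') :
    (prolateCore lam).domain ≤ W'.domain :=
  fun _ hf => hW'.1 ((prolateCore lam).le_closure.1 hf)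

/-- **Door to the domain inclusion of Thm 1.6 (iii)**: if `𝓛_β = dom W_min + span{u₁, …, u₄}` with each
`uᵢ` of the form `P_λ f` or `P̂_λ f` for some `f ∈ 𝒮(ℝ)` (the printed `β± = P_λ f±`,
`β̂± = P̂_λ (𝓕 f±)`), then every extension `W' ⊇ W_min` commuting with `P_λ` and `P̂_λ` has
`𝓛_β ⊆ dom W'`. [cite: ConnesMoscovici2022, Thm 1.6 (iii) and its proof: «must … contain both `P_λ𝒮(ℝ)` and `P̂_λ𝒮(ℝ)`. Thus it must contain `𝓛_β`» (= arXiv:2112.05500 Thm 2.6 (iii), chunk p0006:L76–L79, L91–L93)] -/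
theorem prolateSASet_subset_domain_of_commutesWith (hlam : 0 < lam) {W' : L2R →ₗ.[ℂ] L2R}
    (hW' : prolateMin lam ≤ W') (hP : CommutesWith W' (cutoffProj lam))
    (hPhat : CommutesWith W' (cutoffProjHat lam)) (u : Fin 4 → L2R)
    (hstruct : prolateSADomain lam hlam = (prolateMin lam).domain ⊔ Submodule.span ℂ (Set.range u))
    (hu : ∀ i, ∃ f ∈ (prolateCore lam).domain, u i = cutoffProj lam f ∨ u i = cutoffProjHat lam f) :
    prolateSASet lam ⊆ (W'.domain : Set L2R) := by
  intro ξ hξ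
  have hξ' : ξ ∈ prolateSADomain lam hlam := hξ
  rw [hstruct] at hξ'
  have hcore : (prolateCore lam).domain ≤ W'.domain := prolateCore_domain_le_of_prolateMin_le hW'
  have hui : ∀ i, u i ∈ W'.domain := by
    intro i
    obtain ⟨f, hf, h | h⟩ := hu i
    · obtain ⟨hmem, -⟩ := hP ⟨f, hcore hf⟩
      rw [h]; exact hmem
    · obtain ⟨hmem, -⟩ := hPhat ⟨f, hcore hf⟩
      rw [h]; exact hmem
  have hle : (prolateMin lam).domain ⊔ Submodule.span ℂ (Set.range u) ≤ W'.domain :=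
    sup_le hW'.1 (Submodule.span_le.2 (by rintro _ ⟨i, rfl⟩; exact hui i))
  exact hle hξ'

/-- **Thm 1.6 (iii) from (i)-self-adjointness and the structure of `𝓛_β`** (`𝓛_β = dom W_min + span`
of four vectors of the form `P_λ f`, `P̂_λ f`, `f ∈ 𝒮(ℝ)`). [cite: ConnesMoscovici2022, Thm 1.6 (iii) and its proof: «must … contain both `P_λ𝒮(ℝ)` and `P̂_λ𝒮(ℝ)`. Thus it must contain `𝓛_β`» (= arXiv:2112.05500 Thm 2.6 (iii), chunk p0006:L76–L79, L91–L93)] -/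
theorem CM22_thm_1_6_iii_of_struct (hlam : 0 < lam) (hSA : IsSelfAdjoint (prolateSA lam hlam))
    (u : Fin 4 → L2R)
    (hstruct : prolateSADomain lam hlam = (prolateMin lam).domain ⊔ Submodule.span ℂ (Set.range u))
    (hu : ∀ i, ∃ f ∈ (prolateCore lam).domain, u i = cutoffProj lam f ∨ u i = cutoffProjHat lam f)
    {W : L2R →ₗ.[ℂ] L2R} (hW : IsProlateSA lam W) :
    ∀ W' : L2R →ₗ.[ℂ] L2R, IsSelfAdjoint W' → prolateMin lam ≤ W' →
      CommutesWith W' (cutoffProj lam) → CommutesWith W' (cutoffProjHat lam) → W' = W :=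
  CM22_thm_1_6_iii_of hlam hSA
    (fun _ _ h2 h3 h4 => prolateSASet_subset_domain_of_commutesWith hlam h2 h3 h4 u hstruct hu) hW

/-- **Assembly, structural form**: `CM22_thm_1_6` from (i) self-adjointness of `W_sa`, (i) commutation
with `𝓕`, (ii) commutation with `P̂_λ`, the structure `𝓛_β = dom W_min + span{P_λ f's, P̂_λ f's}`
(which yields (iii)), and (iv) the spectral clause. [cite: ConnesMoscovici2022, Thm 1.6 (i)–(iv) and its proof (= arXiv:2112.05500 Thm 2.6, chunk p0006:L76–L79; proof L81–L114)] -/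
theorem CM22_thm_1_6_of_struct
    (hSA : ∀ (lam : ℝ) (hlam : 0 < lam), IsSelfAdjoint (prolateSA lam hlam))
    (hF : ∀ (lam : ℝ) (hlam : 0 < lam), CommutesWith (prolateSA lam hlam) fourierL2)
    (hPhat : ∀ (lam : ℝ) (hlam : 0 < lam), CommutesWith (prolateSA lam hlam) (cutoffProjHat lam))
    (hstruct : ∀ (lam : ℝ) (hlam : 0 < lam), ∃ u : Fin 4 → L2R,
      prolateSADomain lam hlam = (prolateMin lam).domain ⊔ Submodule.span ℂ (Set.range u) ∧
      ∀ i, ∃ f ∈ (prolateCore lam).domain, u i = cutoffProj lam f ∨ u i = cutoffProjHat lam f)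
    (hspec : ∀ (lam : ℝ) (hlam : 0 < lam), HasDiscreteSpectrumUnboundedBothSides (prolateSA lam hlam)) :
    CM22_thm_1_6 := by
  refine CM22_thm_1_6_of hSA hF hPhat (fun lam hlam W' _ h2 h3 h4 => ?_) hspec
  obtain ⟨u, hs, hu⟩ := hstruct lam hlam
  exact prolateSASet_subset_domain_of_commutesWith hlam h2 h3 h4 u hs hu

end Literature.NumberTheory.ConnesMoscovici2022
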